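import Summits.KontsevichZagierPeriods.KontsevichZagierPeriods.Theorems.InverseLandauFiveTermCertificateFacts

/-!
# `FiveTermCertificate` (route InverseLandau): the certificate data are tame on the cube

Support file for item `stmt-KontsevichZagierPeriods-13875`. The rational functions of
`InverseLandauFiveTermCertificateKit.lean` (names as in its glossary: homotopy `tatePhi`, primitives
`tateB`, `tateA`, weight-one integrands `gOne`, `gTwo`, five-term integrand `abelF`; written out in
full in the statements) are real-analytic at every point
of the closed unit cube and `ℚ`-semialgebraic on it, for real algebraic `0 < x`, `0 < y`,
`x + y < 1`: all denominators are positive on the closed cube (`facts`). Analyticity is assembled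
from sums/products/quotients of coordinates and constants; semialgebraicity from the tree's closure
lemmas (Bochnak–Coste–Roy, Prop. 2.2.6) and the `ℚ`-definability of real algebraic constants
(`isSemialgebraicFunOn_const_of_isAlgebraic`; Kontsevich–Zagier allow algebraic coefficients).

References: J. Bochnak, M. Coste, M.-F. Roy, *Real Algebraic Geometry* (1998), Prop. 2.2.6;
M. Kontsevich, D. Zagier, *Periods* (2001), §1.1.
-/

noncomputable section

namespace Summit.KontsevichZagierPeriods.InverseLandau.FiveTerm

open Set
open Literature.NumberTheory.Transcendental
open Literature.ModelTheory.ExponentialFields (IsSemialgebraic)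

/-! ## Analyticity at the points of the closed cube -/

section Analytic

variable {x y : ℝ} (hx : 0 < x) (hy : 0 < y) (hxy : x + y < 1)
include hx hy hxy

/-- The five-term integrand is analytic near the closed square. [folklore] -/
theorem an_abelF2 : AnalyticOnNhd ℝ (fun z : Fin 2 → ℝ => (x / ((1 - y) - x * (z 0) * (z 1)) + y / ((1 - x) - y * (z 0) * (z 1)) - x / (1 - x * (z 0) * (z 1)) - y / (1 - y * (z 0) * (z 1)) - x * y / ((1 - x) * (1 - y) - x * y * (z 0) * (z 1)) - x / (1 - x * (z 0)) * (y / (1 - y * (z 1))))) (KZ.cube 2) := by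
  intro z hz
  obtain ⟨f01, f02, f03, f04, f05, f06, f07, f08, f09, f10, f11, f12, f13, f14, f15, f16, f17, f18,
    f19, f20, f21, f22, f23, f24, f25⟩ := facts hx hy hxy (mem_Icc_of_mem_cube hz 0)
    (mem_Icc_of_mem_cube hz 1) (mem_Icc_of_mem_cube hz 1)
  repeat (first
    | with_reducible exact an_const _
    | with_reducible exact an_coord _ _
    | with_reducible apply an_add
    | with_reducible apply an_sub
    | with_reducible apply an_div
    | with_reducible apply an_mul
    | with_reducible apply an_neg
    | with_reducible apply an_pow
    | with_reducible apply mul_ne_zero_real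
    | with_reducible apply pow_ne_zero_real
    | (with_reducible apply ne_of_gt; with_reducible assumption))

/-- The five-term integrand, read on the cube `[0,1]³` through `(z₀, z₁)`, is analytic near it.
[folklore] -/
theorem an_abelF3 : AnalyticOnNhd ℝ (fun c : Fin 3 → ℝ => (x / ((1 - y) - x * (c 0) * (c 1)) + y / ((1 - x) - y * (c 0) * (c 1)) - x / (1 - x * (c 0) * (c 1)) - y / (1 - y * (c 0) * (c 1)) - x * y / ((1 - x) * (1 - y) - x * y * (c 0) * (c 1)) - x / (1 - x * (c 0)) * (y / (1 - y * (c 1))))) (KZ.cube 3) := by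
  intro z hz
  obtain ⟨f01, f02, f03, f04, f05, f06, f07, f08, f09, f10, f11, f12, f13, f14, f15, f16, f17, f18,
    f19, f20, f21, f22, f23, f24, f25⟩ := facts hx hy hxy (mem_Icc_of_mem_cube hz 0)
    (mem_Icc_of_mem_cube hz 1) (mem_Icc_of_mem_cube hz 2)
  repeat (first
    | with_reducible exact an_const _
    | with_reducible exact an_coord _ _
    | with_reducible apply an_add
    | with_reducible apply an_sub
    | with_reducible apply an_div
    | with_reducible apply an_mul
    | with_reducible apply an_neg
    | with_reducible apply an_pow
    | with_reducible apply mul_ne_zero_real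
    | with_reducible apply pow_ne_zero_real
    | (with_reducible apply ne_of_gt; with_reducible assumption))

/-- The homotopy `tatePhi (z₀, z₁, w)` is analytic near the cube. [folklore] -/
theorem an_tatePhi :
    AnalyticOnNhd ℝ (fun c : Fin 3 → ℝ => (x * (c 2) / ((1 - y) - (x * (c 0) * (c 1)) * (c 2)) + y / ((1 - y * (c 0) * (c 1)) - x * (c 2)) - x * (c 2) / (1 - (x * (c 0) * (c 1)) * (c 2)) - y / (1 - y * (c 0) * (c 1)) - (x * y) * (c 2) / ((1 - y) - (x * (1 - y) + x * y * (c 0) * (c 1)) * (c 2)) - x * (c 2) / (1 - (x * (c 0)) * (c 2)) * (y / (1 - y * (c 1))))) (KZ.cube 3) := by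
  intro z hz
  obtain ⟨f01, f02, f03, f04, f05, f06, f07, f08, f09, f10, f11, f12, f13, f14, f15, f16, f17, f18,
    f19, f20, f21, f22, f23, f24, f25⟩ := facts hx hy hxy (mem_Icc_of_mem_cube hz 0)
    (mem_Icc_of_mem_cube hz 1) (mem_Icc_of_mem_cube hz 2)
  repeat (first
    | with_reducible exact an_const _
    | with_reducible exact an_coord _ _
    | with_reducible apply an_add
    | with_reducible apply an_sub
    | with_reducible apply an_div
    | with_reducible apply an_mul
    | with_reducible apply an_neg
    | with_reducible apply an_pow
    | with_reducible apply mul_ne_zero_real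
    | with_reducible apply pow_ne_zero_real
    | (with_reducible apply ne_of_gt; with_reducible assumption))

/-- The primitive `tateB (z₀, z₁, w)` is analytic near the cube. [folklore] -/
theorem an_tateB :
    AnalyticOnNhd ℝ (fun c : Fin 3 → ℝ => (x * (c 1) / ((1 - y) - (x * (c 2) * (c 0)) * (c 1)) + (x * y / (1 - x * (c 2))) * (c 1) / ((1 - x * (c 2)) - (y * (c 0)) * (c 1)) - x * (c 1) / (1 - (x * (c 2) * (c 0)) * (c 1)) - (x * y / (1 - x * (c 2))) * (c 1) / ((1 - x * (c 2)) * (1 - y) - (x * (c 2) * y * (c 0)) * (c 1)))) (KZ.cube 3) := by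
  intro z hz
  obtain ⟨f01, f02, f03, f04, f05, f06, f07, f08, f09, f10, f11, f12, f13, f14, f15, f16, f17, f18,
    f19, f20, f21, f22, f23, f24, f25⟩ := facts hx hy hxy (mem_Icc_of_mem_cube hz 0)
    (mem_Icc_of_mem_cube hz 1) (mem_Icc_of_mem_cube hz 2)
  repeat (first
    | with_reducible exact an_const _
    | with_reducible exact an_coord _ _
    | with_reducible apply an_add
    | with_reducible apply an_sub
    | with_reducible apply an_div
    | with_reducible apply an_mul
    | with_reducible apply an_neg
    | with_reducible apply an_pow
    | with_reducible apply mul_ne_zero_real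
    | with_reducible apply pow_ne_zero_real
    | (with_reducible apply ne_of_gt; with_reducible assumption))

/-- The primitive `tateA (z₀, z₁, w)` is analytic near the cube. [folklore] -/
theorem an_tateA :
    AnalyticOnNhd ℝ (fun c : Fin 3 → ℝ => (-(x * (c 0) / (1 - (x * (c 2)) * (c 0)) * (y / (1 - y * (c 1)))))) (KZ.cube 3) := by
  intro z hz
  obtain ⟨f01, f02, f03, f04, f05, f06, f07, f08, f09, f10, f11, f12, f13, f14, f15, f16, f17, f18,
    f19, f20, f21, f22, f23, f24, f25⟩ := facts hx hy hxy (mem_Icc_of_mem_cube hz 0)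
    (mem_Icc_of_mem_cube hz 1) (mem_Icc_of_mem_cube hz 2)
  repeat (first
    | with_reducible exact an_const _
    | with_reducible exact an_coord _ _
    | with_reducible apply an_add
    | with_reducible apply an_sub
    | with_reducible apply an_div
    | with_reducible apply an_mul
    | with_reducible apply an_neg
    | with_reducible apply an_pow
    | with_reducible apply mul_ne_zero_real
    | with_reducible apply pow_ne_zero_real
    | (with_reducible apply ne_of_gt; with_reducible assumption))

/-- `gOne (t, w)` read through `(c₀, c₂)` is analytic near the cube. [folklore] -/
theorem an_gOne : AnalyticOnNhd ℝ (fun c : Fin 3 → ℝ => ((x * 1 / ((1 - y) - (x * (c 2) * (c 0)) * 1) + (x * y / (1 - x * (c 2))) * 1 / ((1 - x * (c 2)) - (y * (c 0)) * 1) - x * 1 / (1 - (x * (c 2) * (c 0)) * 1) - (x * y / (1 - x * (c 2))) * 1 / ((1 - x * (c 2)) * (1 - y) - (x * (c 2) * y * (c 0)) * 1)))) (KZ.cube 3) := by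
  intro z hz
  obtain ⟨f01, f02, f03, f04, f05, f06, f07, f08, f09, f10, f11, f12, f13, f14, f15, f16, f17, f18,
    f19, f20, f21, f22, f23, f24, f25⟩ := facts hx hy hxy (mem_Icc_of_mem_cube hz 0)
    (mem_Icc_of_mem_cube hz 1) (mem_Icc_of_mem_cube hz 2)
  simp only [mul_one]
  repeat (first
    | with_reducible exact an_const _
    | with_reducible exact an_coord _ _
    | with_reducible apply an_add
    | with_reducible apply an_sub
    | with_reducible apply an_div
    | with_reducible apply an_mul
    | with_reducible apply an_neg
    | with_reducible apply an_pow
    | with_reducible apply mul_ne_zero_real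
    | with_reducible apply pow_ne_zero_real
    | (with_reducible apply ne_of_gt; with_reducible assumption))

/-- `gTwo (t, w)` read through `(c₀, c₂)` is analytic near the cube. [folklore] -/
theorem an_gTwo02 : AnalyticOnNhd ℝ (fun c : Fin 3 → ℝ => ((-(x * 1 / (1 - (x * (c 2)) * 1) * (y / (1 - y * (c 0))))))) (KZ.cube 3) := by
  intro z hz
  obtain ⟨f01, f02, f03, f04, f05, f06, f07, f08, f09, f10, f11, f12, f13, f14, f15, f16, f17, f18,
    f19, f20, f21, f22, f23, f24, f25⟩ := facts hx hy hxy (mem_Icc_of_mem_cube hz 0)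
    (mem_Icc_of_mem_cube hz 1) (mem_Icc_of_mem_cube hz 2)
  simp only [mul_one]
  repeat (first
    | with_reducible exact an_const _
    | with_reducible exact an_coord _ _
    | with_reducible apply an_add
    | with_reducible apply an_sub
    | with_reducible apply an_div
    | with_reducible apply an_mul
    | with_reducible apply an_neg
    | with_reducible apply an_pow
    | with_reducible apply mul_ne_zero_real
    | with_reducible apply pow_ne_zero_real
    | (with_reducible apply ne_of_gt; with_reducible assumption))

/-- `gTwo (t, w)` read through `(c₁, c₂)` is analytic near the cube. [folklore] -/
theorem an_gTwo12 : AnalyticOnNhd ℝ (fun c : Fin 3 → ℝ => ((-(x * 1 / (1 - (x * (c 2)) * 1) * (y / (1 - y * (c 1))))))) (KZ.cube 3) := by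
  intro z hz
  obtain ⟨f01, f02, f03, f04, f05, f06, f07, f08, f09, f10, f11, f12, f13, f14, f15, f16, f17, f18,
    f19, f20, f21, f22, f23, f24, f25⟩ := facts hx hy hxy (mem_Icc_of_mem_cube hz 1)
    (mem_Icc_of_mem_cube hz 1) (mem_Icc_of_mem_cube hz 2)
  simp only [mul_one]
  repeat (first
    | with_reducible exact an_const _
    | with_reducible exact an_coord _ _
    | with_reducible apply an_add
    | with_reducible apply an_sub
    | with_reducible apply an_div
    | with_reducible apply an_mul
    | with_reducible apply an_neg
    | with_reducible apply an_pow
    | with_reducible apply mul_ne_zero_real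
    | with_reducible apply pow_ne_zero_real
    | (with_reducible apply ne_of_gt; with_reducible assumption))

end Analytic

/-! ## `ℚ`-semialgebraicity on the closed cube -/

section Semialgebraic

variable {x y : ℝ} (hxa : IsAlgebraic ℚ x) (hya : IsAlgebraic ℚ y)
include hxa hya

/-- The five-term integrand is `ℚ`-semialgebraic on the closed square (real algebraic `x, y` are
`ℚ`-definable constants). [Kontsevich–Zagier 2001, §1.1; Bochnak–Coste–Roy 1998, Prop. 2.2.6] -/
theorem sa_abelF2 : IsSemialgebraicFunOn ℚ (KZ.cube 2) (fun z : Fin 2 → ℝ => (x / ((1 - y) - x * (z 0) * (z 1)) + y / ((1 - x) - y * (z 0) * (z 1)) - x / (1 - x * (z 0) * (z 1)) - y / (1 - y * (z 0) * (z 1)) - x * y / ((1 - x) * (1 - y) - x * y * (z 0) * (z 1)) - x / (1 - x * (z 0)) * (y / (1 - y * (z 1))))) := by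
  have hC : IsSemialgebraic ℚ (KZ.cube 2) := KZ.isSemialgebraic_cube
  have h1 := sa_one hC
  repeat (first
    | with_reducible exact isSemialgebraicFunOn_apply hC _
    | with_reducible exact isSemialgebraicFunOn_const_of_isAlgebraic hC hxa
    | with_reducible exact isSemialgebraicFunOn_const_of_isAlgebraic hC hya
    | with_reducible exact h1
    | with_reducible apply IsSemialgebraicFunOn.fun_add
    | with_reducible apply IsSemialgebraicFunOn.fun_sub
    | with_reducible apply sa_div
    | with_reducible apply IsSemialgebraicFunOn.fun_mul
    | with_reducible apply IsSemialgebraicFunOn.fun_neg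
    | with_reducible apply IsSemialgebraicFunOn.fun_pow)

/-- The five-term integrand read on `[0,1]³` through `(c₀, c₁)` is `ℚ`-semialgebraic.
[Bochnak–Coste–Roy 1998, Prop. 2.2.6] -/
theorem sa_abelF3 : IsSemialgebraicFunOn ℚ (KZ.cube 3) (fun c : Fin 3 → ℝ => (x / ((1 - y) - x * (c 0) * (c 1)) + y / ((1 - x) - y * (c 0) * (c 1)) - x / (1 - x * (c 0) * (c 1)) - y / (1 - y * (c 0) * (c 1)) - x * y / ((1 - x) * (1 - y) - x * y * (c 0) * (c 1)) - x / (1 - x * (c 0)) * (y / (1 - y * (c 1))))) := by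
  have hC : IsSemialgebraic ℚ (KZ.cube 3) := KZ.isSemialgebraic_cube
  have h1 := sa_one hC
  repeat (first
    | with_reducible exact isSemialgebraicFunOn_apply hC _
    | with_reducible exact isSemialgebraicFunOn_const_of_isAlgebraic hC hxa
    | with_reducible exact isSemialgebraicFunOn_const_of_isAlgebraic hC hya
    | with_reducible exact h1
    | with_reducible apply IsSemialgebraicFunOn.fun_add
    | with_reducible apply IsSemialgebraicFunOn.fun_sub
    | with_reducible apply sa_div
    | with_reducible apply IsSemialgebraicFunOn.fun_mul
    | with_reducible apply IsSemialgebraicFunOn.fun_neg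
    | with_reducible apply IsSemialgebraicFunOn.fun_pow)

/-- The homotopy `tatePhi` is `ℚ`-semialgebraic on the cube. [Bochnak–Coste–Roy 1998, Prop. 2.2.6] -/
theorem sa_tatePhi :
    IsSemialgebraicFunOn ℚ (KZ.cube 3) (fun c : Fin 3 → ℝ => (x * (c 2) / ((1 - y) - (x * (c 0) * (c 1)) * (c 2)) + y / ((1 - y * (c 0) * (c 1)) - x * (c 2)) - x * (c 2) / (1 - (x * (c 0) * (c 1)) * (c 2)) - y / (1 - y * (c 0) * (c 1)) - (x * y) * (c 2) / ((1 - y) - (x * (1 - y) + x * y * (c 0) * (c 1)) * (c 2)) - x * (c 2) / (1 - (x * (c 0)) * (c 2)) * (y / (1 - y * (c 1))))) := by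
  have hC : IsSemialgebraic ℚ (KZ.cube 3) := KZ.isSemialgebraic_cube
  have h1 := sa_one hC
  repeat (first
    | with_reducible exact isSemialgebraicFunOn_apply hC _
    | with_reducible exact isSemialgebraicFunOn_const_of_isAlgebraic hC hxa
    | with_reducible exact isSemialgebraicFunOn_const_of_isAlgebraic hC hya
    | with_reducible exact h1
    | with_reducible apply IsSemialgebraicFunOn.fun_add
    | with_reducible apply IsSemialgebraicFunOn.fun_sub
    | with_reducible apply sa_div
    | with_reducible apply IsSemialgebraicFunOn.fun_mul
    | with_reducible apply IsSemialgebraicFunOn.fun_neg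
    | with_reducible apply IsSemialgebraicFunOn.fun_pow)

/-- The primitive `tateB` is `ℚ`-semialgebraic on the cube. [Bochnak–Coste–Roy 1998, Prop. 2.2.6] -/
theorem sa_tateB :
    IsSemialgebraicFunOn ℚ (KZ.cube 3) (fun c : Fin 3 → ℝ => (x * (c 1) / ((1 - y) - (x * (c 2) * (c 0)) * (c 1)) + (x * y / (1 - x * (c 2))) * (c 1) / ((1 - x * (c 2)) - (y * (c 0)) * (c 1)) - x * (c 1) / (1 - (x * (c 2) * (c 0)) * (c 1)) - (x * y / (1 - x * (c 2))) * (c 1) / ((1 - x * (c 2)) * (1 - y) - (x * (c 2) * y * (c 0)) * (c 1)))) := by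
  have hC : IsSemialgebraic ℚ (KZ.cube 3) := KZ.isSemialgebraic_cube
  have h1 := sa_one hC
  repeat (first
    | with_reducible exact isSemialgebraicFunOn_apply hC _
    | with_reducible exact isSemialgebraicFunOn_const_of_isAlgebraic hC hxa
    | with_reducible exact isSemialgebraicFunOn_const_of_isAlgebraic hC hya
    | with_reducible exact h1
    | with_reducible apply IsSemialgebraicFunOn.fun_add
    | with_reducible apply IsSemialgebraicFunOn.fun_sub
    | with_reducible apply sa_div
    | with_reducible apply IsSemialgebraicFunOn.fun_mul
    | with_reducible apply IsSemialgebraicFunOn.fun_neg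
    | with_reducible apply IsSemialgebraicFunOn.fun_pow)

/-- The primitive `tateA` is `ℚ`-semialgebraic on the cube. [Bochnak–Coste–Roy 1998, Prop. 2.2.6] -/
theorem sa_tateA :
    IsSemialgebraicFunOn ℚ (KZ.cube 3) (fun c : Fin 3 → ℝ => (-(x * (c 0) / (1 - (x * (c 2)) * (c 0)) * (y / (1 - y * (c 1)))))) := by
  have hC : IsSemialgebraic ℚ (KZ.cube 3) := KZ.isSemialgebraic_cube
  have h1 := sa_one hC
  repeat (first
    | with_reducible exact isSemialgebraicFunOn_apply hC _
    | with_reducible exact isSemialgebraicFunOn_const_of_isAlgebraic hC hxa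
    | with_reducible exact isSemialgebraicFunOn_const_of_isAlgebraic hC hya
    | with_reducible exact h1
    | with_reducible apply IsSemialgebraicFunOn.fun_add
    | with_reducible apply IsSemialgebraicFunOn.fun_sub
    | with_reducible apply sa_div
    | with_reducible apply IsSemialgebraicFunOn.fun_mul
    | with_reducible apply IsSemialgebraicFunOn.fun_neg
    | with_reducible apply IsSemialgebraicFunOn.fun_pow)

/-- `gOne` read through `(c₀, c₂)` is `ℚ`-semialgebraic on the cube. [Bochnak–Coste–Roy 1998, Prop. 2.2.6] -/
theorem sa_gOne : IsSemialgebraicFunOn ℚ (KZ.cube 3) (fun c : Fin 3 → ℝ => ((x * 1 / ((1 - y) - (x * (c 2) * (c 0)) * 1) + (x * y / (1 - x * (c 2))) * 1 / ((1 - x * (c 2)) - (y * (c 0)) * 1) - x * 1 / (1 - (x * (c 2) * (c 0)) * 1) - (x * y / (1 - x * (c 2))) * 1 / ((1 - x * (c 2)) * (1 - y) - (x * (c 2) * y * (c 0)) * 1)))) := by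
  have hC : IsSemialgebraic ℚ (KZ.cube 3) := KZ.isSemialgebraic_cube
  have h1 := sa_one hC
  repeat (first
    | with_reducible exact isSemialgebraicFunOn_apply hC _
    | with_reducible exact isSemialgebraicFunOn_const_of_isAlgebraic hC hxa
    | with_reducible exact isSemialgebraicFunOn_const_of_isAlgebraic hC hya
    | with_reducible exact h1
    | with_reducible apply IsSemialgebraicFunOn.fun_add
    | with_reducible apply IsSemialgebraicFunOn.fun_sub
    | with_reducible apply sa_div
    | with_reducible apply IsSemialgebraicFunOn.fun_mul
    | with_reducible apply IsSemialgebraicFunOn.fun_neg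
    | with_reducible apply IsSemialgebraicFunOn.fun_pow)

/-- `gTwo` read through `(cᵢ, c₂)` is `ℚ`-semialgebraic on the cube. [Bochnak–Coste–Roy 1998, Prop. 2.2.6] -/
theorem sa_gTwo (i : Fin 3) :
    IsSemialgebraicFunOn ℚ (KZ.cube 3) (fun c : Fin 3 → ℝ => ((-(x * 1 / (1 - (x * (c 2)) * 1) * (y / (1 - y * (c i))))))) := by
  have hC : IsSemialgebraic ℚ (KZ.cube 3) := KZ.isSemialgebraic_cube
  have h1 := sa_one hC
  repeat (first
    | with_reducible exact isSemialgebraicFunOn_apply hC _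
    | with_reducible exact isSemialgebraicFunOn_const_of_isAlgebraic hC hxa
    | with_reducible exact isSemialgebraicFunOn_const_of_isAlgebraic hC hya
    | with_reducible exact h1
    | with_reducible apply IsSemialgebraicFunOn.fun_add
    | with_reducible apply IsSemialgebraicFunOn.fun_sub
    | with_reducible apply sa_div
    | with_reducible apply IsSemialgebraicFunOn.fun_mul
    | with_reducible apply IsSemialgebraicFunOn.fun_neg
    | with_reducible apply IsSemialgebraicFunOn.fun_pow)

end Semialgebraic

end Summit.KontsevichZagierPeriods.InverseLandau.FiveTerm
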